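import Mathlib
import Summits.NavierStokesRegularity.NavierStokesRegularity.Theorems.LerayQuarterDissipationFiniteDissipationLiouvilleWindowCollar
import HarnessLib

/-!
# Crux `FiniteDissipationLiouville` (stmt-NavierStokesRegularity-22144): THRESHOLD ONE RECURS ON THE
# WHOLE STRATUM — every singular member of `𝒟_{C,K}` is super-self-similar by a margin in every window

Theorems file of route `LerayQuarterDissipation` (lead prover g19; `--supports` the crux; sequel of
`…WindowSocketCollar` / `…WindowCollar`; the kill is lead g14's `…ThresholdOne.not_singular_of_typeI_one`,
carried here as an explicit HYPOTHESIS `hT1` so that this module stays outside the route's Theses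
cone — the skeleton discharges it by name). Navier–Stokes regularity
is NOT proved by anything here; no summit is.

The window theorems of `…WindowRecurrence` / `…WindowCollar` for the speed `√(−t)‖u‖` live on the
ENVELOPED frame (`HasTypeIDecay`), because their apex kill (g18's `not_singular_of_speed_le_one_near_apex`)
goes through the similarity-enstrophy scheme, which needs the envelope. In the crux's OWN frame —
KNSS-gauge Type-I + the quarter-rate dissipation LAW, no envelope — lead g14's THRESHOLD ONE
(`…ThresholdOne.not_singular_of_typeI_one`: no singular member of `𝒟_{1,K}`) is an all-time kill at
Type-I constant `1`; the zoom-IN argument turns it into an apex criterion, and the collared window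
socket then runs on the whole stratum:

* `isTypeIAncientMild_of_speed_le` — a member of the class with `√(−t)‖V‖ ≤ θ` everywhere is a
  member with Type-I constant `θ`;
* **`not_singular_of_speed_le_one_near_apex_of_law`** — THRESHOLD ONE NEAR THE APEX ON THE STRATUM
  (modulo `hT1` = threshold one): `IsTypeIAncientMild C V` + law `K` + `√(−t)‖V(t,x)‖ ≤ 1` on a final slab `[τ, 0) × ℝ³` ⇒ NOT
  singular (zoom-in along `e^{−j}`, KNSS limit with speed `≤ 1` EVERYWHERE, i.e. a member of
  `𝒟_{1,K}`, singular by persistence — contradicting threshold one);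
* **`speed_exceeds_margin_in_every_window_of_law`** / **`…_volume_of_law`** / **`…_volume_scaled_of_law`**
  — for all `C, K` there are `ε ∈ (0,1)`, `δ > 0`, `η > 0` such that EVERY SINGULAR MEMBER OF
  `𝒟_{C,K}` has, in every window `[−c², −εc²] × ℝ³`, a set of volume `≥ η c⁵` on which
  `√(−t)‖V‖ > 1 + δ` (no envelope assumed);
* **`not_singular_of_slow_window_of_law`** — THE ONE-WINDOW CRITERION ON THE STRATUM: a member of
  `𝒟_{C,K}` with `√(−t)‖V‖ ≤ 1 + δ(C,K)` throughout ONE window `[−c², −ε(C,K)c²] × ℝ³` is not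
  singular at the apex — `|log ε|` consecutive e-folds below `(1+δ)×` the self-similar speed, at any
  one scale, exclude the singularity (compare g14: Type-I constant `≤ 1 + ε(K)` at ALL times).

HONEST FRAMING. Compactness corollaries (ineffective constants) of lead g14's threshold one, about
HYPOTHETICAL singular members of the stratum; nothing is removed from the DSS wall
(`∀ c>1 TypeIDSSLiouville c`, NECESSARY for the crux). Nothing here bears on NS regularity.

References: Koch–Nadirashvili–Seregin–Šverák, Acta Math. 203 (2009) §4; folklore.
-/

noncomputable section

set_option linter.dupNamespace false

namespace Summit.NavierStokesRegularity.NavierStokesRegularity.Theorems.FiniteDissipationLiouville.WindowRecurrence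

open MeasureTheory Set Filter Topology Metric InnerProductSpace Function Real
open scoped RealInnerProductSpace ContDiff ENNReal
open Literature.Analysis Literature.Analysis.FluidPDE
open Summit.NavierStokesRegularity.NavierStokesRegularity.Theorems
open Summit.NavierStokesRegularity.NavierStokesRegularity.Theorems.RecurrentReductionD
open Summit.NavierStokesRegularity.NavierStokesRegularity.Theorems.FiniteDissipationLiouville
open Summit.NavierStokesRegularity.NavierStokesRegularity.Theorems.FiniteDissipationLiouville.CrossFlow
open Summit.NavierStokesRegularity.NavierStokesRegularity.Theorems.FiniteDissipationLiouville.WindowSocket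

variable {C : ℝ} {V : ℝ → EuclideanSpace ℝ (Fin 3) → EuclideanSpace ℝ (Fin 3)}

/-! ### Threshold one near the apex, on the stratum -/

section Apex

/-- A member of the class with `√(−t)‖V(t,x)‖ ≤ θ` everywhere has Type-I constant `θ`. [folklore] -/
theorem isTypeIAncientMild_of_speed_le {θ : ℝ} (hV : IsTypeIAncientMild C V)
    (h : ∀ t < 0, ∀ x, Real.sqrt (-t) * ‖V t x‖ ≤ θ) : IsTypeIAncientMild θ V := by
  refine ⟨hV.1, hV.2.1, hV.2.2.1, fun t ht x => ?_⟩
  have hs : 0 < Real.sqrt (-t) := Real.sqrt_pos.2 (neg_pos.2 ht)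
  rw [le_div_iff₀ hs, mul_comm]
  exact h t ht x

/-- Scale covariance of the time-restricted speed bound. [folklore] -/
theorem speed_le_nsRescale_from {θ c τ : ℝ} (hc : 0 < c)
    (h : ∀ s : ℝ, τ ≤ s → s < 0 → ∀ y, Real.sqrt (-s) * ‖V s y‖ ≤ θ) :
    ∀ s : ℝ, τ / c ^ 2 ≤ s → s < 0 → ∀ y, Real.sqrt (-s) * ‖nsRescale c V s y‖ ≤ θ := by
  intro s hτs hs y
  have hc2 : 0 < c ^ 2 := by positivity
  have hcs : c ^ 2 * s < 0 := mul_neg_of_pos_of_neg hc2 hs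
  have hτ' : τ ≤ c ^ 2 * s := by
    have := mul_le_mul_of_nonneg_left hτs hc2.le
    rwa [mul_div_cancel₀ _ hc2.ne'] at this
  exact speed_le_at_nsRescale θ V y hc hs (h _ hτ' hcs (c • y))

/-- **THRESHOLD ONE NEAR THE APEX, ON THE STRATUM (no envelope).** A KNSS-gauge Type-I field with the
dissipation law and `√(−t)‖V(t,x)‖ ≤ 1` for all `t ∈ [τ, 0)`, `x` (some `τ < 0`) is NOT singular at
the apex. [KNSS compactness + lead g14's threshold one; cite: KochNadirashviliSereginSverak2009, §4 (arXiv:0709.3599 p. 8)] -/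
theorem not_singular_of_speed_le_one_near_apex_of_law {K : ℝ}
    (hT1 : ∀ u : ℝ → EuclideanSpace ℝ (Fin 3) → EuclideanSpace ℝ (Fin 3), IsTypeIAncientMild 1 u →
      (∀ s : ℝ, s < 0 → ∫⁻ x, ‖fderiv ℝ (u s) x‖ₑ ^ 2 ≤ ENNReal.ofReal (K / Real.sqrt (-s))) →
      ¬ (∀ r > 0, ∀ M : ℝ, ∃ t ∈ Ioo (-(r ^ 2)) (0 : ℝ),
        ∃ x ∈ ball (0 : EuclideanSpace ℝ (Fin 3)) r, M < ‖u t x‖))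
    (hV : IsTypeIAncientMild C V)
    (hlaw : ∀ s : ℝ, s < 0 → ∫⁻ x, ‖fderiv ℝ (V s) x‖ₑ ^ 2 ≤ ENNReal.ofReal (K / Real.sqrt (-s)))
    {τ : ℝ} (hτ : τ < 0) (hb : ∀ s : ℝ, τ ≤ s → s < 0 → ∀ y, Real.sqrt (-s) * ‖V s y‖ ≤ 1) :
    ¬ (∀ r > 0, ∀ M : ℝ, ∃ t ∈ Ioo (-(r ^ 2)) (0 : ℝ),
      ∃ x ∈ ball (0 : EuclideanSpace ℝ (Fin 3)) r, M < ‖V t x‖) := by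
  -- adapted from `…CriticalProduction.not_singular_of_critProdCredit_near_apex` (zoom-in template)
  intro hsing
  obtain ⟨u, hudef⟩ : ∃ u : ℕ → ℝ → EuclideanSpace ℝ (Fin 3) → EuclideanSpace ℝ (Fin 3),
      ∀ j, u j = nsRescale (Real.exp (-(j : ℝ))) V := ⟨_, fun j => rfl⟩
  have hu : ∀ j, IsTypeIAncientMild C (u j) := fun j => by
    rw [hudef]; exact hV.nsRescale (Real.exp_pos _)
  have hlawu : ∀ j, ∀ s : ℝ, s < 0 →
      ∫⁻ x, ‖fderiv ℝ (u j s) x‖ₑ ^ 2 ≤ ENNReal.ofReal (K / Real.sqrt (-s)) := fun j => by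
    rw [hudef]; exact dissipationLaw_nsRescale hlaw (Real.exp_pos _)
  have hsu : ∀ j, ∀ r > 0, ∀ M : ℝ, ∃ t ∈ Ioo (-(r ^ 2)) (0 : ℝ),
      ∃ x ∈ ball (0 : EuclideanSpace ℝ (Fin 3)) r, M < ‖u j t x‖ := fun j => by
    rw [hudef]; exact singularAtOrigin_nsRescale hsing (Real.exp_pos _)
  have hbu : ∀ j : ℕ, ∀ s : ℝ, τ / Real.exp (-(j : ℝ)) ^ 2 ≤ s → s < 0 → ∀ y,
      Real.sqrt (-s) * ‖u j s y‖ ≤ 1 := fun j => by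
    rw [hudef]; exact speed_le_nsRescale_from (Real.exp_pos _) hb
  obtain ⟨ψ, hψ, W, hW, hunif, hpt, hgr⟩ := Compactness.seqLimit hu
  have hψr : Tendsto (fun j => ((ψ j : ℕ) : ℝ)) atTop atTop :=
    tendsto_natCast_atTop_atTop.comp hψ.tendsto_atTop
  have hWsing := Compactness.persistent_singularity_seq (w := fun j => u (ψ j))
    (fun j => hu _) (fun j => hlawu _) (fun j => hsu _) hW hunif
  have hlawW := dissipationLaw_of_tendsto_fderiv (w := fun j => u (ψ j)) (fun j => hlawu (ψ j)) hgr
  have hτj : Tendsto (fun j => τ / Real.exp (-((ψ j : ℕ) : ℝ)) ^ 2) atTop atBot := by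
    have e : ∀ j, τ / Real.exp (-((ψ j : ℕ) : ℝ)) ^ 2 = τ * Real.exp (2 * ((ψ j : ℕ) : ℝ)) := by
      intro j
      rw [div_eq_mul_inv, ← Real.exp_nat_mul, ← Real.exp_neg]
      congr 1; push_cast; ring_nf
    simp_rw [e]
    have h2 : Tendsto (fun j => Real.exp (2 * ((ψ j : ℕ) : ℝ))) atTop atTop :=
      Real.tendsto_exp_atTop.comp (hψr.const_mul_atTop (by norm_num))
    exact h2.const_mul_atTop_of_neg hτ
  -- the limit has speed `≤ 1` everywhere
  have hbW : ∀ t < 0, ∀ x, Real.sqrt (-t) * ‖W t x‖ ≤ 1 := by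
    intro t ht x
    have hL : Tendsto (fun j => Real.sqrt (-t) * ‖u (ψ j) t x‖) atTop (𝓝 (Real.sqrt (-t) * ‖W t x‖)) :=
      ((hpt t ht x).norm).const_mul _
    refine le_of_tendsto hL ?_
    filter_upwards [hτj.eventually (eventually_le_atBot t)] with j hj
    exact hbu (ψ j) t hj ht x
  have hW1 : IsTypeIAncientMild 1 W := isTypeIAncientMild_of_speed_le hW hbW
  exact hT1 W hW1 hlawW hWsing

end Apex

/-! ### Threshold one by a margin, in every window, on the stratum -/

section Windows

/-- **EVERY SINGULAR MEMBER OF THE STRATUM IS SUPER-SELF-SIMILAR BY A MARGIN IN EVERY WINDOW.** For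
all `C, K` there are `ε ∈ (0,1)`, `δ > 0` such that every singular member of `𝒟_{C,K}` has in every
window `[−c², −εc²]`, `c > 0`, a point with `1 + δ < √(−t)‖V(t,x)‖`.
[KNSS compactness + threshold one; cite: KochNadirashviliSereginSverak2009, §4 (arXiv:0709.3599 p. 8)] -/
theorem speed_exceeds_margin_in_every_window_of_law (C K : ℝ)
    (hT1 : ∀ u : ℝ → EuclideanSpace ℝ (Fin 3) → EuclideanSpace ℝ (Fin 3), IsTypeIAncientMild 1 u →
      (∀ s : ℝ, s < 0 → ∫⁻ x, ‖fderiv ℝ (u s) x‖ₑ ^ 2 ≤ ENNReal.ofReal (K / Real.sqrt (-s))) →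
      ¬ (∀ r > 0, ∀ M : ℝ, ∃ t ∈ Ioo (-(r ^ 2)) (0 : ℝ),
        ∃ x ∈ ball (0 : EuclideanSpace ℝ (Fin 3)) r, M < ‖u t x‖)) : ∃ ε : ℝ, 0 < ε ∧ ε < 1 ∧
    ∃ δ : ℝ, 0 < δ ∧
    ∀ (V : ℝ → EuclideanSpace ℝ (Fin 3) → EuclideanSpace ℝ (Fin 3)), IsTypeIAncientMild C V →
      (∀ s : ℝ, s < 0 → ∫⁻ x, ‖fderiv ℝ (V s) x‖ₑ ^ 2 ≤ ENNReal.ofReal (K / Real.sqrt (-s))) →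
      (∀ r > 0, ∀ M : ℝ, ∃ t ∈ Ioo (-(r ^ 2)) (0 : ℝ),
        ∃ x ∈ ball (0 : EuclideanSpace ℝ (Fin 3)) r, M < ‖V t x‖) →
      ∀ c : ℝ, 0 < c → ∃ t ∈ Icc (-c ^ 2) (-(ε * c ^ 2)), ∃ x : EuclideanSpace ℝ (Fin 3),
        1 + δ < Real.sqrt (-t) * ‖V t x‖ := by
  obtain ⟨ε, hε, hε1, δ, hδ, h⟩ := exists_window_margin_of_apex_kill (C := C) (K := K) (θ₀ := 1)
    (Q := fun _ => True) (G := fun θ F t x => Real.sqrt (-t) * ‖F t x‖ ≤ θ)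
    (fun _ _ _ _ => trivial) (fun _ _ _ _ _ _ _ _ => trivial)
    (fun θ F c t x hc ht hG => speed_le_at_nsRescale θ F x hc ht hG)
    (fun u W θ hu hW hunif hpt hgr hθ t ht x hbad => speed_violation_eventually hpt hθ ht x hbad)
    (fun W hW hlawW _ hG => not_singular_of_speed_le_one_near_apex_of_law hT1 hW hlawW (τ := -1/2)
      (by norm_num) fun t h1 h2 x => hG t (by linarith) h2 x)
  refine ⟨ε, hε, hε1, δ, hδ, fun V hV hlaw hsing c hc => ?_⟩
  obtain ⟨t, ht, x, hx⟩ := h V hV hlaw trivial hsing c hc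
  exact ⟨t, ht, x, not_le.1 hx⟩

/-- **… ON A SET OF DEFINITE VOLUME IN THE UNIT WINDOW.** [KNSS compactness + threshold one;
cite: KochNadirashviliSereginSverak2009, §4 (arXiv:0709.3599 p. 8)] -/
theorem speed_exceeds_margin_volume_of_law (C K : ℝ)
    (hT1 : ∀ u : ℝ → EuclideanSpace ℝ (Fin 3) → EuclideanSpace ℝ (Fin 3), IsTypeIAncientMild 1 u →
      (∀ s : ℝ, s < 0 → ∫⁻ x, ‖fderiv ℝ (u s) x‖ₑ ^ 2 ≤ ENNReal.ofReal (K / Real.sqrt (-s))) →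
      ¬ (∀ r > 0, ∀ M : ℝ, ∃ t ∈ Ioo (-(r ^ 2)) (0 : ℝ),
        ∃ x ∈ ball (0 : EuclideanSpace ℝ (Fin 3)) r, M < ‖u t x‖)) : ∃ ε : ℝ, 0 < ε ∧ ε < 1 ∧ ∃ δ : ℝ, 0 < δ ∧
    ∃ η : ℝ, 0 < η ∧
    ∀ (V : ℝ → EuclideanSpace ℝ (Fin 3) → EuclideanSpace ℝ (Fin 3)), IsTypeIAncientMild C V →
      (∀ s : ℝ, s < 0 → ∫⁻ x, ‖fderiv ℝ (V s) x‖ₑ ^ 2 ≤ ENNReal.ofReal (K / Real.sqrt (-s))) →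
      (∀ r > 0, ∀ M : ℝ, ∃ t ∈ Ioo (-(r ^ 2)) (0 : ℝ),
        ∃ x ∈ ball (0 : EuclideanSpace ℝ (Fin 3)) r, M < ‖V t x‖) →
      ENNReal.ofReal η ≤ volume {p : ℝ × EuclideanSpace ℝ (Fin 3) | p.1 ∈ Icc (-1 : ℝ) (-ε) ∧
        1 + δ < Real.sqrt (-p.1) * ‖V p.1 p.2‖} := by
  obtain ⟨ε, hε, hε1, δ, hδ, η, hη, h⟩ := exists_window_margin_volume_of_apex_kill (C := C) (K := K)
    (θ₀ := 1) (Q := fun _ => True) (G := fun θ F t x => Real.sqrt (-t) * ‖F t x‖ ≤ θ)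
    (fun _ _ _ _ _ _ _ _ => trivial)
    (fun u W θ hu hW hunif hpt hgr hθ t ht x hbad => speed_violation_eventually hpt hθ ht x hbad)
    (fun θ U hU _ => isOpen_speed_violation hU θ)
    (fun W hW hlawW _ hG => not_singular_of_speed_le_one_near_apex_of_law hT1 hW hlawW (τ := -1/2)
      (by norm_num) fun t h1 h2 x => hG t (by linarith) h2 x)
  refine ⟨ε, hε, hε1, δ, hδ, η, hη, fun V hV hlaw hsing => ?_⟩
  exact (h V hV hlaw trivial hsing).trans (measure_mono fun p hp => ⟨hp.1, not_le.1 hp.2⟩)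

/-- **… AND VOLUME `≥ η c⁵` IN EVERY WINDOW `[−c², −εc²]`.** [folklore; cite: KochNadirashviliSereginSverak2009, §4 (arXiv:0709.3599 p. 8)] -/
theorem speed_exceeds_margin_volume_scaled_of_law (C K : ℝ)
    (hT1 : ∀ u : ℝ → EuclideanSpace ℝ (Fin 3) → EuclideanSpace ℝ (Fin 3), IsTypeIAncientMild 1 u →
      (∀ s : ℝ, s < 0 → ∫⁻ x, ‖fderiv ℝ (u s) x‖ₑ ^ 2 ≤ ENNReal.ofReal (K / Real.sqrt (-s))) →
      ¬ (∀ r > 0, ∀ M : ℝ, ∃ t ∈ Ioo (-(r ^ 2)) (0 : ℝ),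
        ∃ x ∈ ball (0 : EuclideanSpace ℝ (Fin 3)) r, M < ‖u t x‖)) : ∃ ε : ℝ, 0 < ε ∧ ε < 1 ∧
    ∃ δ : ℝ, 0 < δ ∧ ∃ η : ℝ, 0 < η ∧
    ∀ (V : ℝ → EuclideanSpace ℝ (Fin 3) → EuclideanSpace ℝ (Fin 3)), IsTypeIAncientMild C V →
      (∀ s : ℝ, s < 0 → ∫⁻ x, ‖fderiv ℝ (V s) x‖ₑ ^ 2 ≤ ENNReal.ofReal (K / Real.sqrt (-s))) →
      (∀ r > 0, ∀ M : ℝ, ∃ t ∈ Ioo (-(r ^ 2)) (0 : ℝ),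
        ∃ x ∈ ball (0 : EuclideanSpace ℝ (Fin 3)) r, M < ‖V t x‖) →
      ∀ c : ℝ, 0 < c →
      ENNReal.ofReal (η * c ^ 5) ≤ volume {p : ℝ × EuclideanSpace ℝ (Fin 3) |
        p.1 ∈ Icc (-c ^ 2) (-(ε * c ^ 2)) ∧ 1 + δ < Real.sqrt (-p.1) * ‖V p.1 p.2‖} := by
  obtain ⟨ε, hε, hε1, δ, hδ, η, hη, h⟩ := speed_exceeds_margin_volume_of_law C K hT1
  refine ⟨ε, hε, hε1, δ, hδ, η, hη, fun V hV hlaw hsing c hc => ?_⟩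
  have h1 := h (nsRescale c V) (hV.nsRescale hc) (dissipationLaw_nsRescale hlaw hc)
    (singularAtOrigin_nsRescale hsing hc)
  have h2 := volume_window_scaled (G := fun F t x => Real.sqrt (-t) * ‖F t x‖ ≤ 1 + δ)
    (fun F c' t x hc' ht hG => speed_le_at_nsRescale (1 + δ) F x hc' ht hG) hε hc (V := V) (η := η)
    (h1.trans (measure_mono fun p hp => ⟨hp.1, not_le.2 hp.2⟩))
  exact h2.trans (measure_mono fun p hp => ⟨hp.1, not_le.1 hp.2⟩)

/-- **THE ONE-WINDOW CRITERION ON THE STRATUM.** There are `ε(C,K) ∈ (0,1)`, `δ(C,K) > 0`: a member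
of `𝒟_{C,K}` (KNSS-gauge Type-I constant `C` + the dissipation law with constant `K`) such that
`√(−t)‖V(t,x)‖ ≤ 1 + δ` for all `(t,x)` in ONE window `[−c², −εc²] × ℝ³` (some `c > 0`) is NOT
singular at the apex. [KNSS compactness + threshold one; cite: KochNadirashviliSereginSverak2009, §4 (arXiv:0709.3599 p. 8)] -/
theorem not_singular_of_slow_window_of_law (C K : ℝ)
    (hT1 : ∀ u : ℝ → EuclideanSpace ℝ (Fin 3) → EuclideanSpace ℝ (Fin 3), IsTypeIAncientMild 1 u →
      (∀ s : ℝ, s < 0 → ∫⁻ x, ‖fderiv ℝ (u s) x‖ₑ ^ 2 ≤ ENNReal.ofReal (K / Real.sqrt (-s))) →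
      ¬ (∀ r > 0, ∀ M : ℝ, ∃ t ∈ Ioo (-(r ^ 2)) (0 : ℝ),
        ∃ x ∈ ball (0 : EuclideanSpace ℝ (Fin 3)) r, M < ‖u t x‖)) : ∃ ε : ℝ, 0 < ε ∧ ε < 1 ∧ ∃ δ : ℝ, 0 < δ ∧
    ∀ (V : ℝ → EuclideanSpace ℝ (Fin 3) → EuclideanSpace ℝ (Fin 3)), IsTypeIAncientMild C V →
      (∀ s : ℝ, s < 0 → ∫⁻ x, ‖fderiv ℝ (V s) x‖ₑ ^ 2 ≤ ENNReal.ofReal (K / Real.sqrt (-s))) →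
      ∀ c : ℝ, 0 < c →
      (∀ t ∈ Icc (-c ^ 2) (-(ε * c ^ 2)), ∀ x : EuclideanSpace ℝ (Fin 3),
        Real.sqrt (-t) * ‖V t x‖ ≤ 1 + δ) →
      ¬ (∀ r > 0, ∀ M : ℝ, ∃ t ∈ Ioo (-(r ^ 2)) (0 : ℝ),
        ∃ x ∈ ball (0 : EuclideanSpace ℝ (Fin 3)) r, M < ‖V t x‖) := by
  obtain ⟨ε, hε, hε1, δ, hδ, h⟩ := speed_exceeds_margin_in_every_window_of_law C K hT1
  refine ⟨ε, hε, hε1, δ, hδ, fun V hV hlaw c hc hslow hsing => ?_⟩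
  obtain ⟨t, ht, x, hx⟩ := h V hV hlaw hsing c hc
  exact (not_le.2 hx) (hslow t ht x)

end Windows

end Summit.NavierStokesRegularity.NavierStokesRegularity.Theorems.FiniteDissipationLiouville.WindowRecurrence

end
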